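import Literature.Probability.RandomPlanarGeometry.SAWSpliceDefs
import HarnessLib

/-!
# The spliced walk: decoding and the weighted energy–entropy bound

Continuation of `SAWSpliceDefs.lean` (H. Duminil-Copin, G. Kozma, A. Yadin, *Supercritical
self-avoiding walks are space-filling*, Ann. IHP Probab. Stat. 50 (2014), §3, proof of
Proposition 7: "given a path `γ` there is a limited number of ways it may be written as
`f(γ₁,γ₂)` … `ℓ` has only a limited number of possibilities, say `4^{100m}` … `f` is at most
`100m²`-to-one"). Given the template and the direction bit, the pair (walk, structure) is
recovered from the spliced walk (`Splice.Data.newList_inj`, the list form of "given `ℓ` … this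
gives `γ₁`"): the prefix up to the first site strictly inside the ball is the untouched beginning
of the walk, then come the fixed lane and route, then the structure up to the first arena site,
then fixed pieces again. Summing, with the side data (template, direction bit) ranging over at
most `80 (d₀ + 1)` values, gives the weighted bound `Splice.weighted_sum_le`:
`Σ_{l ∈ E} Σ_{c ∈ 𝒞} x^{|l|-1+|S_c|} ≤ 80 (d₀+1) · max(1,x⁻¹)^{10 d₀ + 3} · Z(D,u,v,x)`,
the list form of the printed display `Z_{Θ_F}(x) · Z_F(x) ≤ 4^{100m} max(x⁶, x^{-100m+4}) Z_{(Ω,a,b)}(x)`,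
with `80 (d₀+1) · max(1,x⁻¹)^{10 d₀+3}` in the role of `4^{100m} max(x⁶, x^{-100m+4})`. The
counting lemma `sum_le_of_injOn_sideData'` is the finite-side-values twin of
`SAWLists.sum_le_of_injOn_sideData` (which is its case `Sσ = univ`).
-/

noncomputable section

open Finset Literature.Probability.LatticeModels

namespace Literature.Probability.RandomPlanarGeometry.SAW

/-! ### A counting lemma with finitely many side values -/

/-- Weighted injectivity-up-to-side-information bound, with the side values confined to a finite
set `Sσ`: `Σ_{a ∈ A} w_A(a) ≤ K · |Sσ| · Σ_{b ∈ B} w_B(b)` (twin of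
`SAWLists.sum_le_of_injOn_sideData`, the case `Sσ = univ` of a finite type). [folklore] -/
theorem sum_le_of_injOn_sideData' {α β σ : Type*} [DecidableEq β] [DecidableEq σ]
    (A : Finset α) (B : Finset β) (Sσ : Finset σ) (f : α → β) (g : α → σ) (wA : α → ℝ) (wB : β → ℝ)
    {K : ℝ} (hK : 0 ≤ K) (hwB : ∀ b ∈ B, 0 ≤ wB b) (hf : ∀ a ∈ A, f a ∈ B) (hg : ∀ a ∈ A, g a ∈ Sσ)
    (hinj : Set.InjOn (fun a => (g a, f a)) A) (hle : ∀ a ∈ A, wA a ≤ K * wB (f a)) :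
    ∑ a ∈ A, wA a ≤ K * Sσ.card * ∑ b ∈ B, wB b := by
  classical
  calc ∑ a ∈ A, wA a ≤ ∑ a ∈ A, K * wB (f a) := sum_le_sum hle
    _ = K * ∑ a ∈ A, wB (f a) := (mul_sum _ _ _).symm
    _ = K * ∑ s ∈ Sσ, ∑ a ∈ A.filter (fun a => g a = s), wB (f a) := by
        rw [← sum_fiberwise_of_maps_to (g := g) (t := Sσ) hg]
    _ ≤ K * ∑ _s ∈ Sσ, ∑ b ∈ B, wB b := by
        refine mul_le_mul_of_nonneg_left (sum_le_sum fun s _ => ?_) hK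
        have hinj' : Set.InjOn f (A.filter fun a => g a = s) := by
          intro a ha a' ha' hfa
          simp only [coe_filter, Set.mem_setOf_eq] at ha ha'
          exact hinj ha.1 ha'.1 (by simp [ha.2, ha'.2, hfa])
        calc ∑ a ∈ A.filter (fun a => g a = s), wB (f a)
            = ∑ b ∈ (A.filter fun a => g a = s).image f, wB b := (sum_image hinj').symm
          _ ≤ ∑ b ∈ B, wB b :=
            sum_le_sum_of_subset_of_nonneg (fun b hb => by
              obtain ⟨a, ha, rfl⟩ := mem_image.1 hb
              exact hf a (mem_filter.1 ha).1) fun b hb _ => hwB b hb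
    _ = K * Sσ.card * ∑ b ∈ B, wB b := by
        rw [sum_const, nsmul_eq_mul, mul_assoc]

/-- Cancellation of decodings: `P ++ M ++ (K ++ R) = P ++ M' ++ (K ++ R')` with `M, M'` avoiding
a predicate that the head of the non-empty `K` satisfies forces `M = M'` and `R = R'`.
[folklore] -/
theorem decode_core {V : Type*} {p : V → Bool} {P M M' K R R' : List V} (hM : ∀ a ∈ M, p a = false)
    (hM' : ∀ a ∈ M', p a = false) (hK : K ≠ []) (hk : ∀ k ∈ K.head?, p k = true)
    (h : P ++ (M ++ (K ++ R)) = P ++ (M' ++ (K ++ R'))) : M = M' ∧ R = R' := by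
  have h1 := List.append_cancel_left h
  have hk' : ∀ k ∈ (K ++ R).head?, p k = true := fun k hk'' => hk k (by
    rw [List.head?_append_of_ne_nil _ hK] at hk''; exact hk'')
  have hk'' : ∀ k ∈ (K ++ R').head?, p k = true := fun k hk'' => hk k (by
    rw [List.head?_append_of_ne_nil _ hK] at hk''; exact hk'')
  obtain ⟨h2, h3⟩ := append_inj_of_head hM hk' hM' hk'' h1
  exact ⟨h2, List.append_cancel_left h3⟩

namespace Splice

variable {m r : ℕ}

namespace Data

variable (X : Data m r)

/-! ### Changing the structure -/

/-- The same splice data with another structure. [folklore] -/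
def withS (S' : List (Site 2)) : Data m r := ⟨X.T, X.t', X.dp, S', X.d₀, X.wf, X.hz₀, X.big⟩

/-- Fields and derived objects that do not depend on the structure. [folklore] -/
@[simp] theorem withS_T (S' : List (Site 2)) : (X.withS S').T = X.T := rfl
/-- see `withS_T`. [folklore] -/
@[simp] theorem withS_S (S' : List (Site 2)) : (X.withS S').S = S' := rfl
/-- see `withS_T`. [folklore] -/
@[simp] theorem withS_t' (S' : List (Site 2)) : (X.withS S').t' = X.t' := rfl
/-- see `withS_T`. [folklore] -/
@[simp] theorem withS_dp (S' : List (Site 2)) : (X.withS S').dp = X.dp := rfl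
/-- see `withS_T`. [folklore] -/
@[simp] theorem withS_d₀ (S' : List (Site 2)) : (X.withS S').d₀ = X.d₀ := rfl
/-- see `withS_T`. [folklore] -/
@[simp] theorem withS_LD (S' : List (Site 2)) : (X.withS S').LD = X.LD := rfl
/-- see `withS_T`. [folklore] -/
@[simp] theorem withS_pa (S' : List (Site 2)) : (X.withS S').pa = X.pa := rfl
/-- see `withS_T`. [folklore] -/
@[simp] theorem withS_pb (S' : List (Site 2)) : (X.withS S').pb = X.pb := rfl
/-- see `withS_T`. [folklore] -/
@[simp] theorem withS_rCW (S' : List (Site 2)) : (X.withS S').rCW = X.rCW := rfl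
/-- see `withS_T`. [folklore] -/
@[simp] theorem withS_rCCW (S' : List (Site 2)) : (X.withS S').rCCW = X.rCCW := rfl
/-- see `withS_T`. [folklore] -/
@[simp] theorem withS_pathSites (S' : List (Site 2)) : (X.withS S').pathSites = X.pathSites := rfl
/-- The structure piece after changing the structure. [folklore] -/
theorem withS_M (S' : List (Site 2)) :
    (X.withS S').M = if X.rCCW.getLast? = some X.pa then S' else S'.reverse := rfl
/-- `withS` with the own structure is the identity. [folklore] -/
@[simp] theorem withS_self : X.withS X.S = X := rfl

/-- Two splice data with the same template, tile, port side and radius differ only in the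
structure. [folklore] -/
theorem eq_withS {X X' : Data m r} (hT : X'.T = X.T) (ht : X'.t' = X.t') (hd : X'.dp = X.dp)
    (hd₀ : X'.d₀ = X.d₀) : X' = X.withS X'.S := by
  obtain ⟨T, t', dp, S, d₀, wf, hz₀, big⟩ := X
  obtain ⟨T', t'', dp', S', d₀', wf', hz₀', big'⟩ := X'
  simp only at hT ht hd hd₀
  subst hT; subst ht; subst hd; subst hd₀
  rfl

/-! ### The static pieces of the path -/

/-- The piece of the path before the structure. [folklore] -/
def K₁ : List (Site 2) := X.LD.laneL ++ X.rCCW.tail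

/-- The piece of the path after the structure. [folklore] -/
def K₂ : List (Site 2) := X.rCW.reverse ++ X.LD.laneR.reverse.tail

/-- The path is `K₁ ++ M ++ K₂`. [folklore] -/
theorem path_eq : X.path = X.K₁ ++ X.M ++ X.K₂ := by
  simp [path, K₁, K₂, List.append_assoc]

/-- `K₂` is non-empty and starts in the arena. [folklore] -/
theorem K₂_head : X.K₂ ≠ [] ∧ ∀ k ∈ X.K₂.head?, k ∈ OddTile.arena m r X.t' := by
  have hne : X.rCW.reverse ≠ [] := by simpa [rCW] using X.Q.routeCW_ne_nil X.i₀ X.j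
  refine ⟨by simp [K₂, hne], fun k hk => ?_⟩
  rw [K₂, List.head?_append_of_ne_nil _ hne, List.head?_reverse] at hk
  exact X.mem_arena_route (Or.inl (List.mem_of_mem_getLast? hk))

/-- `K₁` is non-empty and ends in the arena. [folklore] -/
theorem K₁_last : X.K₁ ≠ [] ∧ ∀ k ∈ X.K₁.reverse.head?, k ∈ OddTile.arena m r X.t' := by
  obtain ⟨-, -, -, -, -, -, hlL, -, -, hneL, -⟩ := X.LD.lanes_spec
  obtain ⟨-, -, -, -, -, hh2, -⟩ := X.Q.routes_spec X.i₀ X.j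
  have e1 : X.LD.laneL.getLast? = X.rCCW.head? := by rw [hlL, rCCW, hh2, X.cyc_i₀.1]
  refine ⟨by simp [K₁, hneL], fun k hk => ?_⟩
  rw [List.head?_reverse, K₁, getLast?_append_tail e1 hneL] at hk
  exact X.mem_arena_route (Or.inr (List.mem_of_mem_getLast? hk))

/-- The excursion in terms of the static pieces, uniformly in the structure. [folklore] -/
theorem exc_eq : (∀ S', (X.withS S').exc = X.K₁ ++ (X.withS S').M ++ X.K₂) ∨
    (∀ S', (X.withS S').exc = X.K₂.reverse ++ (X.withS S').M.reverse ++ X.K₁.reverse) := by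
  classical
  by_cases h : X.T.i₁ = X.LD.Lpt
  · left; intro S'
    rw [exc, if_pos (show (X.withS S').T.i₁ = (X.withS S').LD.Lpt from h), path_eq]; rfl
  · right; intro S'
    rw [exc, if_neg (show ¬(X.withS S').T.i₁ = (X.withS S').LD.Lpt from h), path_eq]
    simp [K₁, K₂, List.reverse_append]

/-! ### Decoding -/

/-- The structure determines `S` from `M`, uniformly. [folklore] -/
theorem S_eq_of_M_eq {S' : List (Site 2)} (h : X.M = (X.withS S').M) : X.S = S' := by
  rw [withS_M, M] at h
  split_ifs at h with hc
  · exact h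
  · exact List.reverse_injective h

/-- **Decoding.** With the same template, tile, port side, radius and direction bit, the spliced
walk determines the walk and the structure.
[cite: DuminilCopinKozmaYadin2014, §3 (proof of Proposition 7: "given ℓ … this gives γ₁"; "f is at most 100m²-to-one")] -/
theorem newList_inj {D : Finset (Site 2)} {u v : Site 2} {l l' S' : List (Site 2)} (H : X.Hyp D u v l)
    (H' : (X.withS S').Hyp D u v l') (hdir : (X.T.seg <:+: l ↔ X.T.seg <:+: l'))
    (h : X.newList l = (X.withS S').newList l') : l = l' ∧ X.S = S' := by
  classical
  -- the ball predicate and the arena predicate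
  let pB : Site 2 → Bool := fun w => decide (l1dist w X.T.F.z₀ < X.d₀)
  let pA : Site 2 → Bool := fun w => decide (w ∈ OddTile.arena m r X.t')
  have hgeom := X.T.geom X.three_le_d₀ X.wf
  obtain ⟨-, -, hh, hl, -, -⟩ := X.exc_spec H
  obtain ⟨-, -, hh', hl', -, -⟩ := (X.withS S').exc_spec H'
  have hMS := (X.M_spec H).1
  have hMS' := ((X.withS S').M_spec H').1
  have hMA : ∀ a ∈ X.M, pA a = false := fun a ha => by
    simpa [pA] using H.Sarena a ((hMS a).1 ha)
  have hMA' : ∀ a ∈ (X.withS S').M, pA a = false := fun a ha => by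
    simpa [pA] using H'.Sarena a ((hMS' a).1 ha)
  have hMAr : ∀ a ∈ X.M.reverse, pA a = false := fun a ha => hMA a (List.mem_reverse.1 ha)
  have hMAr' : ∀ a ∈ (X.withS S').M.reverse, pA a = false := fun a ha => hMA' a (List.mem_reverse.1 ha)
  obtain ⟨hK2ne, hK2⟩ := X.K₂_head
  obtain ⟨hK1ne, hK1⟩ := X.K₁_last
  have hK2' : ∀ k ∈ X.K₂.head?, pA k = true := fun k hk => by simpa [pA] using hK2 k hk
  have hK1' : ∀ k ∈ X.K₁.reverse.head?, pA k = true := fun k hk => by simpa [pA] using hK1 k hk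
  have hK1rne : X.K₁.reverse ≠ [] := by simpa using hK1ne
  -- the core: from equality of the excursions-with-continuations, recover structure and continuation
  have core : ∀ R R' : List (Site 2), X.exc ++ R = (X.withS S').exc ++ R' → X.S = S' ∧ R = R' := by
    intro R R' he
    rcases X.exc_eq with hE | hE
    · have e1 : X.exc = X.K₁ ++ X.M ++ X.K₂ := hE X.S
      rw [e1, hE S'] at he
      simp only [List.append_assoc] at he
      obtain ⟨h1, h2⟩ := decode_core hMA hMA' hK2ne hK2' he
      exact ⟨X.S_eq_of_M_eq h1, h2⟩
    · have e1 : X.exc = X.K₂.reverse ++ X.M.reverse ++ X.K₁.reverse := hE X.S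
      rw [e1, hE S'] at he
      simp only [List.append_assoc] at he
      obtain ⟨h1, h2⟩ := decode_core hMAr hMAr' hK1rne hK1' he
      exact ⟨X.S_eq_of_M_eq (List.reverse_injective h1), h2⟩
  have corer : ∀ R R' : List (Site 2), X.exc.reverse ++ R = (X.withS S').exc.reverse ++ R' → X.S = S' ∧ R = R' := by
    intro R R' he
    rcases X.exc_eq with hE | hE
    · have e1 : X.exc = X.K₁ ++ X.M ++ X.K₂ := hE X.S
      rw [e1, hE S'] at he
      simp only [List.reverse_append, List.append_assoc] at he
      obtain ⟨h1, h2⟩ := decode_core hMAr hMAr' hK1rne hK1' he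
      exact ⟨X.S_eq_of_M_eq (List.reverse_injective h1), h2⟩
    · have e1 : X.exc = X.K₂.reverse ++ X.M.reverse ++ X.K₁.reverse := hE X.S
      rw [e1, hE S'] at he
      simp only [List.reverse_append, List.reverse_reverse, List.append_assoc] at he
      obtain ⟨h1, h2⟩ := decode_core hMA hMA' hK2ne hK2' he
      exact ⟨X.S_eq_of_M_eq h1, h2⟩
  -- points of the walks and of the template are outside the open ball
  have hpre : ∀ {pre l₀ : List (Site 2)}, (∀ w ∈ l₀, X.d₀ ≤ l1dist w X.T.F.z₀) → (∀ w ∈ pre, w ∈ l₀) →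
      ∀ a ∈ pre, pB a = false := fun hfree hsub a ha => by
    have := hfree a (hsub a ha); simpa [pB] using not_lt.2 this
  have hgB : pB X.T.g = false := by simpa [pB] using (show ¬ l1dist X.T.g X.T.F.z₀ < X.d₀ by rw [hgeom.2.2.2.2.2.2.1]; omega)
  have hs₂B : pB X.T.s₂ = false := by simpa [pB] using not_lt.2 hgeom.2.2.2.2.2.2.2.1
  have htailB : ∀ a ∈ X.T.tail, pB a = false := fun a ha => by
    have := hgeom.2.2.2.2.2.1 a ha; simpa [pB] using (show ¬ l1dist a X.T.F.z₀ < X.d₀ by omega)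
  have hi₁B : pB X.T.i₁ = true := by simpa [pB] using (show l1dist X.T.i₁ X.T.F.z₀ < X.d₀ by rw [hgeom.2.2.2.1]; omega)
  have hi₂B : pB X.T.i₂ = true := by simpa [pB] using (show l1dist X.T.i₂ X.T.F.z₀ < X.d₀ by rw [hgeom.2.2.2.2.1]; omega)
  rcases X.newList_eq H with ⟨pre, post, hl0, hnew, hseg⟩ | ⟨pre, post, hl0, hnew, hseg⟩ <;>
    rcases (X.withS S').newList_eq H' with ⟨pre', post', hl0', hnew', hseg'⟩ | ⟨pre', post', hl0', hnew', hseg'⟩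
  · -- both forward
    rw [hnew, hnew'] at h
    have e : (pre ++ [X.T.g]) ++ (X.exc ++ (X.T.tail ++ X.T.s₂ :: post)) =
        (pre' ++ [X.T.g]) ++ ((X.withS S').exc ++ (X.T.tail ++ X.T.s₂ :: post')) := by
      simpa [ins, List.append_assoc] using h
    have hA : ∀ a ∈ pre ++ [X.T.g], pB a = false := fun a ha => by
      rcases List.mem_append.1 ha with ha | ha
      · exact hpre H.free (fun w hw => by rw [hl0]; simp [hw]) a ha
      · simp only [List.mem_singleton] at ha; rw [ha]; exact hgB
    have hA' : ∀ a ∈ pre' ++ [X.T.g], pB a = false := fun a ha => by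
      rcases List.mem_append.1 ha with ha | ha
      · exact hpre H'.free (fun w hw => by rw [hl0']; simp [hw]) a ha
      · simp only [List.mem_singleton] at ha; rw [ha]; exact hgB
    have hB : ∀ b ∈ (X.exc ++ (X.T.tail ++ X.T.s₂ :: post)).head?, pB b = true := fun b hb => by
      rw [List.head?_append_of_ne_nil _ (by intro h0; rw [h0] at hh; simp at hh), hh] at hb
      simp only [Option.mem_def, Option.some.injEq] at hb; subst hb; exact hi₁B
    have hB' : ∀ b ∈ ((X.withS S').exc ++ (X.T.tail ++ X.T.s₂ :: post')).head?, pB b = true := fun b hb => by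
      rw [List.head?_append_of_ne_nil _ (by intro h0; rw [h0] at hh'; simp at hh'), hh'] at hb
      simp only [Option.mem_def, Option.some.injEq] at hb; subst hb; exact hi₁B
    obtain ⟨h1, h2⟩ := append_inj_of_head hA hB hA' hB' e
    have hpp : pre = pre' := List.append_cancel_right h1
    obtain ⟨hS, h3⟩ := core _ _ h2
    have hpost : post = post' := by
      have := List.append_cancel_left h3
      simpa using this
    refine ⟨?_, hS⟩
    rw [hl0, hl0', hpp, hpost]; rfl
  · exact absurd (hdir.1 hseg) hseg'
  · exact absurd (hdir.2 hseg') hseg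
  · -- both backward
    rw [hnew, hnew'] at h
    have e : (pre ++ X.T.s₂ :: X.T.tail.reverse) ++ (X.exc.reverse ++ X.T.g :: post) =
        (pre' ++ X.T.s₂ :: X.T.tail.reverse) ++ ((X.withS S').exc.reverse ++ X.T.g :: post') := by
      simpa [ins, List.reverse_append, List.append_assoc] using h
    have hA : ∀ a ∈ pre ++ X.T.s₂ :: X.T.tail.reverse, pB a = false := fun a ha => by
      rcases List.mem_append.1 ha with ha | ha
      · exact hpre H.free (fun w hw => by rw [hl0]; simp [hw]) a ha
      · rcases List.mem_cons.1 ha with ha | ha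
        · rw [ha]; exact hs₂B
        · exact htailB a (List.mem_reverse.1 ha)
    have hA' : ∀ a ∈ pre' ++ X.T.s₂ :: X.T.tail.reverse, pB a = false := fun a ha => by
      rcases List.mem_append.1 ha with ha | ha
      · exact hpre H'.free (fun w hw => by rw [hl0']; simp [hw]) a ha
      · rcases List.mem_cons.1 ha with ha | ha
        · rw [ha]; exact hs₂B
        · exact htailB a (List.mem_reverse.1 ha)
    have hB : ∀ b ∈ (X.exc.reverse ++ X.T.g :: post).head?, pB b = true := fun b hb => by
      rw [List.head?_append_of_ne_nil _ (by intro h0; rw [List.reverse_eq_nil_iff] at h0; rw [h0] at hh; simp at hh),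
        List.head?_reverse, hl] at hb
      simp only [Option.mem_def, Option.some.injEq] at hb; subst hb; exact hi₂B
    have hB' : ∀ b ∈ ((X.withS S').exc.reverse ++ X.T.g :: post').head?, pB b = true := fun b hb => by
      rw [List.head?_append_of_ne_nil _ (by intro h0; rw [List.reverse_eq_nil_iff] at h0; rw [h0] at hh'; simp at hh'),
        List.head?_reverse, hl'] at hb
      simp only [Option.mem_def, Option.some.injEq] at hb; subst hb; exact hi₂B
    obtain ⟨h1, h2⟩ := append_inj_of_head hA hB hA' hB' e
    have hpp : pre = pre' := List.append_cancel_right h1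
    obtain ⟨hS, h3⟩ := corer _ _ h2
    have hpost : post = post' := by simpa using h3
    refine ⟨?_, hS⟩
    rw [hl0, hl0', hpp, hpost]; rfl

end Data

/-! ### The weighted bound -/

/-- Weight comparison for one pair: `x^{|l|-1+|S|} ≤ max(1,x⁻¹)^{10 d₀ + 3} x^{|new|-1}`. [folklore] -/
theorem pow_le_of_length {x : ℝ} (hx : 0 < x) {a b n K : ℕ} (h1 : a + b ≤ n) (h2 : n ≤ a + b + K) (ha : 1 ≤ a) :
    x ^ (a - 1 + b) ≤ max 1 x⁻¹ ^ K * x ^ (n - 1) := by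
  rcases le_or_gt x 1 with hx1 | hx1
  · -- `x ≤ 1`: `x^{a-1+b} = x^{n-1} · x^{-(n-a-b)} ≤ x^{n-1} x^{-K}`
    have hinv : 1 ≤ x⁻¹ := one_le_inv_iff₀.2 ⟨hx, hx1⟩
    have hmax : max 1 x⁻¹ = x⁻¹ := max_eq_right hinv
    rw [hmax]
    have e : n - 1 = (a - 1 + b) + (n - a - b) := by omega
    have hk : n - a - b ≤ K := by omega
    calc x ^ (a - 1 + b) = x ^ (a - 1 + b) * (x⁻¹ ^ (n - a - b) * x ^ (n - a - b)) := by
          rw [← mul_pow, inv_mul_cancel₀ hx.ne', one_pow, mul_one]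
      _ ≤ x ^ (a - 1 + b) * (x⁻¹ ^ K * x ^ (n - a - b)) := by
          refine mul_le_mul_of_nonneg_left ?_ (pow_nonneg hx.le _)
          exact mul_le_mul_of_nonneg_right (pow_le_pow_right₀ hinv hk) (pow_nonneg hx.le _)
      _ = x⁻¹ ^ K * x ^ (n - 1) := by rw [e, pow_add]; ring
  · have hmax : max 1 x⁻¹ = 1 := max_eq_left (inv_le_one_of_one_le₀ hx1.le)
    rw [hmax, one_pow, one_mul]
    exact pow_le_pow_right₀ hx1.le (by omega)

/-- Equality of frames from equality of the data. [folklore] -/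
theorem Frame.mk_eq_iff {z z' ex ex' ey ey' : Site 2} {h : IsFramePair ex ey} {h' : IsFramePair ex' ey'} :
    (⟨z, ex, ey, h⟩ : Frame) = ⟨z', ex', ey', h'⟩ ↔ z = z' ∧ ex = ex' ∧ ey = ey' := by
  constructor
  · intro e; cases e; exact ⟨rfl, rfl, rfl⟩
  · rintro ⟨rfl, rfl, rfl⟩; rfl

/-- The templates at a centre with a given radius: at most `8 · 5 · (d₀ + 1)` of them. [folklore] -/
theorem card_templates_le (z₀ : Site 2) (d₀ : ℤ) (hd : 0 ≤ d₀) :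
    ∃ TS : Finset Template, (TS.card : ℝ) ≤ 40 * (d₀ + 1) ∧
      ∀ T : Template, T.F.z₀ = z₀ → T.WF d₀ → T ∈ TS := by
  classical
  -- the eight frames at `z₀`
  let F0 := Frame.std z₀
  let frames : Finset Frame := {F0, F0.mirror, F0.flipY, F0.mirror.flipY, F0.swap, F0.mirror.swap,
    F0.flipY.swap, F0.mirror.flipY.swap}
  have hframes : ∀ F : Frame, F.z₀ = z₀ → F ∈ frames := by
    intro F hF
    obtain ⟨z, ex, ey, hv⟩ := F
    simp only at hF; subst hF
    rcases hv with ⟨h1, h2 | h2⟩ | ⟨h1, h2 | h2⟩ | ⟨h1, h2 | h2⟩ | ⟨h1, h2 | h2⟩ <;> subst h1 <;> subst h2 <;>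
      simp [frames, F0, Frame.std, Frame.mirror, Frame.flipY, Frame.swap, neg_pt, site_eq_iff]
  have hcard_frames : frames.card ≤ 8 := by
    simp only [frames]
    refine (Finset.card_insert_le _ _).trans ?_
    refine Nat.succ_le_succ ((Finset.card_insert_le _ _).trans (Nat.succ_le_succ ?_))
    refine (Finset.card_insert_le _ _).trans (Nat.succ_le_succ ?_)
    refine (Finset.card_insert_le _ _).trans (Nat.succ_le_succ ?_)
    refine (Finset.card_insert_le _ _).trans (Nat.succ_le_succ ?_)
    refine (Finset.card_insert_le _ _).trans (Nat.succ_le_succ ?_)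
    refine (Finset.card_insert_le _ _).trans (Nat.succ_le_succ ?_)
    simp
  let TS : Finset Template := ((frames ×ˢ Finset.range (d₀.toNat + 1)) ×ˢ (Finset.univ : Finset Shape)).image
    fun a => ⟨a.1.1, a.1.2, d₀ - a.1.2, a.2⟩
  refine ⟨TS, ?_, fun T hT hWF => ?_⟩
  · have h1 : TS.card ≤ frames.card * (d₀.toNat + 1) * 5 := by
      refine Finset.card_image_le.trans ?_
      rw [Finset.card_product, Finset.card_product, Finset.card_range]
      have : (Finset.univ : Finset Shape).card = 5 := rfl
      rw [this]
    have h2 : (TS.card : ℝ) ≤ 8 * (d₀.toNat + 1) * 5 := by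
      have : TS.card ≤ 8 * (d₀.toNat + 1) * 5 :=
        h1.trans (Nat.mul_le_mul_right _ (Nat.mul_le_mul_right _ hcard_frames))
      exact_mod_cast this
    have h3 : ((d₀.toNat : ℕ) : ℝ) = (d₀ : ℝ) := by
      have := Int.toNat_of_nonneg hd; exact_mod_cast this
    rw [h3] at h2
    linarith
  · obtain ⟨F, p, q, sh⟩ := T
    simp only at hT
    have hpq : 0 ≤ p ∧ p ≤ d₀ ∧ q = d₀ - p := by
      cases sh <;> simp only [Template.WF] at hWF <;> omega
    refine Finset.mem_image.2 ⟨((F, p.toNat), sh), ?_, ?_⟩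
    · simp only [Finset.mem_product, Finset.mem_range, Finset.mem_univ, and_true]
      exact ⟨hframes F hT, by omega⟩
    · simp only [Int.toNat_of_nonneg hpq.1, hpq.2.2]

/-- **The weighted energy–entropy bound of the surgery.** Let `E` be a finite set of
self-avoiding walks in `D` from `u` to `v`, each carrying a template `Tf l`, and `𝒞` a finite
family of structures `ext c` (injective in `c`), such that every pair satisfies the splice
hypotheses for the same tile, port side and radius `d₀`. Then
`Σ_{l ∈ E} Σ_{c ∈ 𝒞} x^{|l|-1+|ext c|} ≤ 80 (d₀+1) · max(1,x⁻¹)^{10 d₀+3} · Z(D,u,v,x)`.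
[cite: DuminilCopinKozmaYadin2014, §3 (proof of Proposition 7: "Z_{Θ_F}(x) · Z_F(x) ≤ 4^{100m} max(x⁶, x^{-100m+4}) Z_{(Ω,a,b)}(x)")] -/
theorem weighted_sum_le {ι : Type*} (D : Finset (Site 2)) (u v : Site 2) {x : ℝ} (hx : 0 < x)
    (t' : Site 2) (dp : Dir) (d₀ : ℤ) (E : Finset (List (Site 2))) (Tf : List (Site 2) → Template)
    (𝒞 : Finset ι) (ext : ι → List (Site 2)) (hext : Set.InjOn ext 𝒞)
    (Xf : List (Site 2) → ι → Data m r)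
    (hXf : ∀ l ∈ E, ∀ c ∈ 𝒞, (Xf l c).T = Tf l ∧ (Xf l c).t' = t' ∧ (Xf l c).dp = dp ∧ (Xf l c).d₀ = d₀ ∧
      (Xf l c).S = ext c ∧ (Xf l c).Hyp D u v l) (hd : 0 ≤ d₀) :
    ∑ l ∈ E, ∑ c ∈ 𝒞, x ^ (l.length - 1 + (ext c).length) ≤
      80 * (d₀ + 1) * max 1 x⁻¹ ^ (10 * d₀ + 3).toNat * listPartition (zdGraph 2) D u v x := by
  classical
  obtain ⟨TS, hTS, hTSmem⟩ := card_templates_le (OddTile.ctr m r t') d₀ hd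
  rw [← Finset.sum_product']
  -- side data: the template and the direction bit
  let g : List (Site 2) × ι → Template × Bool := fun a => (Tf a.1, decide ((Tf a.1).seg <:+: a.1))
  let f : List (Site 2) × ι → List (Site 2) := fun a => (Xf a.1 a.2).newList a.1
  have key := sum_le_of_injOn_sideData' (E ×ˢ 𝒞) (domSawLists (zdGraph 2) D u v) (TS ×ˢ (Finset.univ : Finset Bool)) f g
    (fun a => x ^ (a.1.length - 1 + (ext a.2).length)) (fun l => x ^ (l.length - 1))
    (K := max 1 x⁻¹ ^ (10 * d₀ + 3).toNat) (pow_nonneg (le_max_left 1 _ |> fun h => zero_le_one.trans h) _)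
    (fun b _ => pow_nonneg hx.le _) ?_ ?_ ?_ ?_
  · refine key.trans ?_
    rw [listPartition]
    have hZ : 0 ≤ ∑ b ∈ domSawLists (zdGraph 2) D u v, x ^ (b.length - 1) := sum_nonneg fun b _ => pow_nonneg hx.le _
    have hK : 0 ≤ max 1 x⁻¹ ^ (10 * d₀ + 3).toNat := pow_nonneg (zero_le_one.trans (le_max_left _ _)) _
    have hcard : (((TS ×ˢ (Finset.univ : Finset Bool)).card : ℕ) : ℝ) ≤ 80 * (d₀ + 1) := by
      rw [Finset.card_product, Finset.card_univ, Fintype.card_bool]; push_cast; linarith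
    calc max 1 x⁻¹ ^ (10 * d₀ + 3).toNat * ((TS ×ˢ (Finset.univ : Finset Bool)).card : ℝ) *
          ∑ b ∈ domSawLists (zdGraph 2) D u v, x ^ (b.length - 1)
        ≤ max 1 x⁻¹ ^ (10 * d₀ + 3).toNat * (80 * (d₀ + 1)) * ∑ b ∈ domSawLists (zdGraph 2) D u v, x ^ (b.length - 1) := by
          refine mul_le_mul_of_nonneg_right (mul_le_mul_of_nonneg_left hcard hK) hZ
      _ = _ := by ring
  · -- the spliced list is a walk
    rintro ⟨l, c⟩ ha
    obtain ⟨hl, hc⟩ := Finset.mem_product.1 ha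
    exact (Xf l c).newList_mem (hXf l hl c hc).2.2.2.2.2
  · -- the side data are confined
    rintro ⟨l, c⟩ ha
    obtain ⟨hl, hc⟩ := Finset.mem_product.1 ha
    obtain ⟨hT, ht, hdp, hd₀, hS, hH⟩ := hXf l hl c hc
    refine Finset.mem_product.2 ⟨hTSmem (Tf l) ?_ ?_, Finset.mem_univ _⟩
    · rw [← hT, (Xf l c).hz₀, ht]
    · rw [← hT, ← hd₀]; exact (Xf l c).wf
  · -- injectivity given the side data
    rintro ⟨l, c⟩ ha ⟨l', c'⟩ ha' heq
    obtain ⟨hl, hc⟩ := Finset.mem_product.1 ha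
    obtain ⟨hl', hc'⟩ := Finset.mem_product.1 ha'
    simp only [Prod.mk.injEq, g, f] at heq
    obtain ⟨⟨hTT, hdir⟩, hnew⟩ := heq
    obtain ⟨hT, ht, hdp, hd₀, hS, hH⟩ := hXf l hl c hc
    obtain ⟨hT', ht', hdp', hd₀', hS', hH'⟩ := hXf l' hl' c' hc'
    have hX' : Xf l' c' = (Xf l c).withS (Xf l' c').S :=
      Data.eq_withS (by rw [hT', hT, hTT]) (by rw [ht', ht]) (by rw [hdp', hdp]) (by rw [hd₀', hd₀])
    rw [hX'] at hnew hH'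
    have hdir2 : ((Tf l).seg <:+: l ↔ (Tf l').seg <:+: l') := decide_eq_decide.1 hdir
    rw [← hTT] at hdir2
    have hdir' : ((Xf l c).T.seg <:+: l ↔ (Xf l c).T.seg <:+: l') := by rw [hT]; exact hdir2
    obtain ⟨hll, hSS⟩ := (Xf l c).newList_inj hH hH' hdir' hnew
    subst hll
    have : c = c' := hext hc hc' (by rw [← hS, hSS, hS'])
    subst this
    rfl
  · -- weights
    rintro ⟨l, c⟩ ha
    obtain ⟨hl, hc⟩ := Finset.mem_product.1 ha
    obtain ⟨hT, ht, hdp, hd₀, hS, hH⟩ := hXf l hl c hc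
    obtain ⟨h1, h2⟩ := (Xf l c).length_newList hH
    rw [hS] at h1 h2
    have hne := (mem_domSawLists.1 hH.mem).1.ne_nil
    have hlen : 1 ≤ l.length := List.length_pos_of_ne_nil hne
    rw [hd₀] at h2
    have ht := Int.toNat_of_nonneg (show 0 ≤ 10 * d₀ + 3 by omega)
    have h2' : ((Xf l c).newList l).length ≤ l.length + (ext c).length + (10 * d₀ + 3).toNat := by omega
    exact pow_le_of_length hx h1 h2' hlen

end Splice

end Literature.Probability.RandomPlanarGeometry.SAW
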